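import Mathlib
import HarnessLib
import Summits.HubbardSuperconductivity.HubbardSuperconductivity.Theorems.KLProgrammeKLRegimeEngineFrameShiftResponseDoorCT
import Summits.HubbardSuperconductivity.HubbardSuperconductivity.Theorems.KLProgrammeKLRegimeTwoVolumeFrameMismatchResponse
import Summits.HubbardSuperconductivity.HubbardSuperconductivity.Theorems.KLProgrammeKLRegimeSplitConsts

/-!
# K3 gen-8-FLOW (stmt 20437 `KLRegimeEngineV17F2`, stub (C), located risk «(C)-B-REP», design B-CT p2 g13): the corrected (B) door COMPOSED in the
# MISMATCH-RESUMMED representation — reading jets of `klLocSelfEnergyRe[K₂] − klLocSelfEnergyRe[K₁] − D` at a point, loop channel BY NAME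

Cell gate-hubbard-kl, seat p2 g13 (memo `B-CT-DESIGN-p2g13.md`, evidence on 20437).  Inputs of record: k3c4-p2's p549694 `…TwoVolumeFrameMismatchResum`
(`klSelfEnergy_frame_eq_chain_add_dressed`: at EVERY lattice momentum `Σ[T_n(K₂)] = βL²κ − βL²κ²Ψ̃ + (1 − κΨ̃)²·Σ[𝒲′[Ψ̃]]`, `κ = D(p_k)/βL²`, `D = K₂ ⊖ K₁`,
`𝒲′[s] = effAction (normalCovariance s) (V_U + 𝒩_{K₁})`, `Ψ̃` the mismatch-resummed symbol; the defect `d = Ψ̃ − Ψ_{K₁}` is SINGLE-SCALE) and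
`…TwoVolumeFrameMismatchResponse` (`sum_norm_mismatchDefect_le_shell`: `Σ‖d‖ ≤ 2N_ω(N₁+N₂)·βL²(200+200B₁)fd/Λ²`), and p2 g13's per-functional door
`…EngineFrameShiftResponseDoorCT.covRespCT_readingJet_sub_le`.  Here (e₀ = klE0, `Λ = Λ_n`):

* `re_klSelfEnergy_frame_eq_add` — the identity read in the currency of `klLocSelfEnergyRe`: `Re Σ[T_n(K₂)]((i,k),σ) = D(p_k) + Re Σ[𝒲′[Ψ̃]]((i,k),σ) + Re J((i,k),σ)`,
  `J = −βL²κ²Ψ̃ + ((1−κΨ̃)² − 1)·Σ[𝒲′[Ψ̃]]` (the DRESSING data; `= 0` wherever `Ψ_{K₂}((i,k),σ) = 0`, `dressing_eq_zero_of_symbol_eq_zero`);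
* `klLocSelfEnergyRe_sub_sub_eval_eq` — `klLocSelfEnergyRe[K₂] − klLocSelfEnergyRe[K₁] − D∘p = (¼Σ_σΣ_± Re Σ[𝒲′[Ψ̃]] − ¼Σ_σΣ_± Re Σ[𝒲′[Ψ_{K₁}]]) + ¼Σ_σΣ_± Re J`;
* **`norm_iteratedFDeriv_klLocSelfEnergyRe_frame_sub_le`** — THE DOOR: for every `j`, `q`,
  `‖Dʲ[evalM (symInterp L (klLocSelfEnergyRe[K₂] − klLocSelfEnergyRe[K₁] − D∘p))](q)‖ ≤ 4|β|L²·12·(2N_ω(N₁+N₂)·βL²(200+200B₁)fd/Λ_n²)·N + (A+A′)/2 + A_J`,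
  hypotheses: `fd ≤ Λ_n/4`, the shell counts `N_ω, N₁, N₂`, `Z` units/non-vanishing along `Ψ_{K₁} + t·d`, the ONE tower input `N` = pinned
  `(1+|x̃|)ʲ`-moments of the four-leg data of `𝒲′[Ψ_{K₁}+t·d]` at the loop strings `(K σ 0)(K σ 1)(Ā)(A)` for loop labels `A` ON THE SCALE-`n` SHELL
  (`|ω_A| < Λ_n` and `|e_{K₁}| < Λ_n ∨ |e_{K₂}| < Λ_n` — elsewhere `d(A) = 0`), the TREE jets `A, A′` and the DRESSING jets `A_J` at `q` (both to be
  discharged by the sup/aliasing route: their data vanish on the below-shell region, memo §3).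
LAW (memo §2, ≈): with `N ≈ U/(4!(βL²)³)` (bare, j-free), `N_ω ≤ Λβ/π+3`, `N_j ≤ 1793(Λ+fd)L²+704L`, `fd ≤ Gfr₀U16^{−n}`: first term
`≈ 2.3·10⁶(1+B₁)Gfr₀·U²·16^{−n}`, scale-free against `curveJetBar · · U 0 (n+1)`.
Proofs only; no definitions; nothing about `N`, `A`, `A′`, `A_J`, `Z` or the sizes of `T_n` is asserted; nothing asserts superconductivity.
References: FST 1996 §1; Salmhofer 1998 §3.1; BGM 2006 §2.3 (2.17), (2.21)–(2.24), §3 (3.3) [cite: BenfattoGiulianiMastropietro2006].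
-/

noncomputable section

namespace Summit.HubbardSuperconductivity.HubbardSuperconductivity.Theorems.EngineV8

set_option linter.dupNamespace false -- summit = problem name (single-conjunct summit), D-0017

open Finset Literature.MathematicalPhysics.QuantumLattice Literature.Probability.LatticeModels GrassmannAlgebra
open Summit.HubbardSuperconductivity.HubbardSuperconductivity.Theorems.KLRegimeSplit
open Summit.HubbardSuperconductivity.HubbardSuperconductivity.Theorems.TwoVolumeDefect
open Summit.HubbardSuperconductivity.HubbardSuperconductivity.Theorems.KLProgrammeLegKernels

variable {L M : ℕ} [NeZero L] [NeZero M]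

section Door

variable {β : ℝ} (hβ : 0 < β) (U μ : ℝ) (K₁ K₂ : TrigPolyC4v) (n : ℕ)
include hβ

/-! ## §1 The identity in the reading currency -/

omit [NeZero M] in
/-- **`Re Σ[T_n(K₂)]((i,k),σ) = D(p_k) + Re Σ[𝒲′[Ψ̃]]((i,k),σ) + Re J((i,k),σ)`** at every lattice momentum — k3c4-p2's `klSelfEnergy_frame_eq_chain_add_dressed`
with the semigroup step undone and the mismatch coefficient `βL²·(D/βL²) = D` evaluated. [cite: FeldmanSalmhoferTrubowitz1996, §1] -/
theorem re_klSelfEnergy_frame_eq_add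
    (hZ₂ : IsUnit (effPartitionFn ℂ (normalCovariance L M (uvSymbolCT L M β μ K₂ (klScale klE0 n)))
      (hubbardInteraction L M β U + counterQuadratic L M β K₂)))
    (hZ₁ : IsUnit (effPartitionFn ℂ (normalCovariance L M (uvSymbolCT L M β μ K₁ (klScale klE0 n)))
      (hubbardInteraction L M β U + counterQuadratic L M β K₁)))
    (i : MatsubaraIdx M) (kv : TorusSite 2 L) (σ : Fin 2) :
    (klSelfEnergy L M β U μ K₂ klE0 n (i, kv) σ).re =
      (fsub K₂ K₁).eval (latticeMomentum L kv) +
      (selfEnergy L M β (effAction ℂ (normalCovariance L M fun ks =>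
          uvSymbolCT L M β μ K₂ (klScale klE0 n) ks /
            (1 + uvSymbolCT L M β μ K₂ (klScale klE0 n) ks * (((fsub K₂ K₁).eval (latticeMomentum L ks.1.2) / (β * (L : ℝ) ^ 2) : ℝ) : ℂ)))
        (hubbardInteraction L M β U + counterQuadratic L M β K₁)) (i, kv) σ).re +
      (-(((β * (L : ℝ) ^ 2 : ℝ) : ℂ) * (((fsub K₂ K₁).eval (latticeMomentum L kv) / (β * (L : ℝ) ^ 2) : ℝ) : ℂ) ^ 2 *
          (uvSymbolCT L M β μ K₂ (klScale klE0 n) ((i, kv), σ) /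
            (1 + uvSymbolCT L M β μ K₂ (klScale klE0 n) ((i, kv), σ) * (((fsub K₂ K₁).eval (latticeMomentum L kv) / (β * (L : ℝ) ^ 2) : ℝ) : ℂ)))) +
        ((1 - (((fsub K₂ K₁).eval (latticeMomentum L kv) / (β * (L : ℝ) ^ 2) : ℝ) : ℂ) *
            (uvSymbolCT L M β μ K₂ (klScale klE0 n) ((i, kv), σ) /
              (1 + uvSymbolCT L M β μ K₂ (klScale klE0 n) ((i, kv), σ) * (((fsub K₂ K₁).eval (latticeMomentum L kv) / (β * (L : ℝ) ^ 2) : ℝ) : ℂ)))) ^ 2 - 1) *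
          selfEnergy L M β (effAction ℂ (normalCovariance L M fun ks =>
            uvSymbolCT L M β μ K₂ (klScale klE0 n) ks /
              (1 + uvSymbolCT L M β μ K₂ (klScale klE0 n) ks * (((fsub K₂ K₁).eval (latticeMomentum L ks.1.2) / (β * (L : ℝ) ^ 2) : ℝ) : ℂ)))
          (hubbardInteraction L M β U + counterQuadratic L M β K₁)) (i, kv) σ).re := by
  have hβ' : (β : ℂ) ≠ 0 := by exact_mod_cast hβ.ne'
  have hL' : (L : ℂ) ≠ 0 := by exact_mod_cast NeZero.ne L
  rw [klSelfEnergy_frame_eq_chain_add_dressed hβ U μ K₁ K₂ klE0 n hZ₂ hZ₁ (i, kv) σ,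
    ← effAction_mismatchResummed_eq_effAction_defect_klEffectiveAction U μ K₁ K₂ klE0 n hZ₁]
  have hκ : ((β * (L : ℝ) ^ 2 : ℝ) : ℂ) * (((fsub K₂ K₁).eval (latticeMomentum L kv) / (β * (L : ℝ) ^ 2) : ℝ) : ℂ) =
      ((fsub K₂ K₁).eval (latticeMomentum L kv) : ℂ) := by
    push_cast
    field_simp
  -- isolate the mismatch coefficient
  set z₁ := ((β * (L : ℝ) ^ 2 : ℝ) : ℂ) * (((fsub K₂ K₁).eval (latticeMomentum L kv) / (β * (L : ℝ) ^ 2) : ℝ) : ℂ) ^ 2 *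
      (uvSymbolCT L M β μ K₂ (klScale klE0 n) ((i, kv), σ) /
        (1 + uvSymbolCT L M β μ K₂ (klScale klE0 n) ((i, kv), σ) * (((fsub K₂ K₁).eval (latticeMomentum L kv) / (β * (L : ℝ) ^ 2) : ℝ) : ℂ))) with hz₁
  set m := (1 - (((fsub K₂ K₁).eval (latticeMomentum L kv) / (β * (L : ℝ) ^ 2) : ℝ) : ℂ) *
      (uvSymbolCT L M β μ K₂ (klScale klE0 n) ((i, kv), σ) /
        (1 + uvSymbolCT L M β μ K₂ (klScale klE0 n) ((i, kv), σ) * (((fsub K₂ K₁).eval (latticeMomentum L kv) / (β * (L : ℝ) ^ 2) : ℝ) : ℂ)))) with hm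
  set S := selfEnergy L M β (effAction ℂ (normalCovariance L M fun ks =>
      uvSymbolCT L M β μ K₂ (klScale klE0 n) ks /
        (1 + uvSymbolCT L M β μ K₂ (klScale klE0 n) ks * (((fsub K₂ K₁).eval (latticeMomentum L ks.1.2) / (β * (L : ℝ) ^ 2) : ℝ) : ℂ)))
      (hubbardInteraction L M β U + counterQuadratic L M β K₁)) (i, kv) σ with hS
  rw [hκ]
  have halg : ((fsub K₂ K₁).eval (latticeMomentum L kv) : ℂ) - z₁ + m ^ 2 * S =
      ((fsub K₂ K₁).eval (latticeMomentum L kv) : ℂ) + S + (-z₁ + (m ^ 2 - 1) * S) := by ring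
  rw [halg, Complex.add_re, Complex.add_re, Complex.ofReal_re]

/-- **The averaged reading data decompose**: `klLocSelfEnergyRe[K₂] − klLocSelfEnergyRe[K₁] − D∘p = (response data) + (dressing data)`. [folklore] -/
theorem klLocSelfEnergyRe_sub_sub_eval_eq
    (hZ₂ : IsUnit (effPartitionFn ℂ (normalCovariance L M (uvSymbolCT L M β μ K₂ (klScale klE0 n)))
      (hubbardInteraction L M β U + counterQuadratic L M β K₂)))
    (hZ₁ : IsUnit (effPartitionFn ℂ (normalCovariance L M (uvSymbolCT L M β μ K₁ (klScale klE0 n)))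
      (hubbardInteraction L M β U + counterQuadratic L M β K₁))) :
    (fun kv : TorusSite 2 L => klLocSelfEnergyRe L M β U μ K₂ n kv - klLocSelfEnergyRe L M β U μ K₁ n kv - (fsub K₂ K₁).eval (latticeMomentum L kv)) =
      fun kv =>
        ((∑ σ : Fin 2, ((selfEnergy L M β (effAction ℂ (normalCovariance L M fun ks =>
              uvSymbolCT L M β μ K₂ (klScale klE0 n) ks /
                (1 + uvSymbolCT L M β μ K₂ (klScale klE0 n) ks * (((fsub K₂ K₁).eval (latticeMomentum L ks.1.2) / (β * (L : ℝ) ^ 2) : ℝ) : ℂ)))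
            (hubbardInteraction L M β U + counterQuadratic L M β K₁)) (omega0 M, kv) σ).re +
          (selfEnergy L M β (effAction ℂ (normalCovariance L M fun ks =>
              uvSymbolCT L M β μ K₂ (klScale klE0 n) ks /
                (1 + uvSymbolCT L M β μ K₂ (klScale klE0 n) ks * (((fsub K₂ K₁).eval (latticeMomentum L ks.1.2) / (β * (L : ℝ) ^ 2) : ℝ) : ℂ)))
            (hubbardInteraction L M β U + counterQuadratic L M β K₁)) ((omega0 M).rev, kv) σ).re)) / 4 -
        (∑ σ : Fin 2, ((selfEnergy L M β (effAction ℂ (normalCovariance L M (uvSymbolCT L M β μ K₁ (klScale klE0 n)))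
            (hubbardInteraction L M β U + counterQuadratic L M β K₁)) (omega0 M, kv) σ).re +
          (selfEnergy L M β (effAction ℂ (normalCovariance L M (uvSymbolCT L M β μ K₁ (klScale klE0 n)))
            (hubbardInteraction L M β U + counterQuadratic L M β K₁)) ((omega0 M).rev, kv) σ).re)) / 4) +
        (∑ σ : Fin 2, ∑ i ∈ ({omega0 M, (omega0 M).rev} : Finset (MatsubaraIdx M)),
          (-(((β * (L : ℝ) ^ 2 : ℝ) : ℂ) * (((fsub K₂ K₁).eval (latticeMomentum L kv) / (β * (L : ℝ) ^ 2) : ℝ) : ℂ) ^ 2 *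
              (uvSymbolCT L M β μ K₂ (klScale klE0 n) ((i, kv), σ) /
                (1 + uvSymbolCT L M β μ K₂ (klScale klE0 n) ((i, kv), σ) * (((fsub K₂ K₁).eval (latticeMomentum L kv) / (β * (L : ℝ) ^ 2) : ℝ) : ℂ)))) +
            ((1 - (((fsub K₂ K₁).eval (latticeMomentum L kv) / (β * (L : ℝ) ^ 2) : ℝ) : ℂ) *
                (uvSymbolCT L M β μ K₂ (klScale klE0 n) ((i, kv), σ) /
                  (1 + uvSymbolCT L M β μ K₂ (klScale klE0 n) ((i, kv), σ) * (((fsub K₂ K₁).eval (latticeMomentum L kv) / (β * (L : ℝ) ^ 2) : ℝ) : ℂ)))) ^ 2 -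
                1) *
              selfEnergy L M β (effAction ℂ (normalCovariance L M fun ks =>
                uvSymbolCT L M β μ K₂ (klScale klE0 n) ks /
                  (1 + uvSymbolCT L M β μ K₂ (klScale klE0 n) ks * (((fsub K₂ K₁).eval (latticeMomentum L ks.1.2) / (β * (L : ℝ) ^ 2) : ℝ) : ℂ)))
              (hubbardInteraction L M β U + counterQuadratic L M β K₁)) (i, kv) σ).re) / 4 := by
  funext kv
  have hne : (omega0 M) ≠ (omega0 M).rev := by
    intro h
    have h2 := congrArg (fun i : MatsubaraIdx M => matsubaraFreq β M i) h
    simp only [matsubaraFreq_omega0_rev] at h2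
    have hpos : 0 < matsubaraFreq β M (omega0 M) := by rw [matsubaraFreq_omega0]; positivity
    have hπ : 0 < Real.pi / β := by positivity
    rw [matsubaraFreq_omega0] at h2 hpos
    linarith
  simp only [klLocSelfEnergyRe, Finset.sum_pair hne, Fin.sum_univ_two]
  rw [re_klSelfEnergy_frame_eq_add hβ U μ K₁ K₂ n hZ₂ hZ₁ (omega0 M) kv 0, re_klSelfEnergy_frame_eq_add hβ U μ K₁ K₂ n hZ₂ hZ₁ (omega0 M) kv 1,
    re_klSelfEnergy_frame_eq_add hβ U μ K₁ K₂ n hZ₂ hZ₁ (omega0 M).rev kv 0, re_klSelfEnergy_frame_eq_add hβ U μ K₁ K₂ n hZ₂ hZ₁ (omega0 M).rev kv 1,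
    klSelfEnergy_eq_selfEnergy_normalCovariance β U μ K₁ klE0 n, klSelfEnergy_eq_selfEnergy_normalCovariance β U μ K₁ klE0 n,
    klSelfEnergy_eq_selfEnergy_normalCovariance β U μ K₁ klE0 n, klSelfEnergy_eq_selfEnergy_normalCovariance β U μ K₁ klE0 n]
  ring

/-! ## §2 The door -/

/-- **THE CORRECTED (B) DOOR, MISMATCH-RESUMMED, JET FORM.**  For the scale-`n` one-shot actions of one volume at two frames `K₁, K₂` (`D = K₂ ⊖ K₁`,
`|D| ≤ fd ≤ Λ_n/4`), shell counts `N_ω ≥ #{i : |ω_i| < Λ_n}`, `N_j ≥ #{k⃗ : |e_{K_j}| < Λ_n}`, partition functions non-vanishing (frame `K₂`; along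
`Ψ_{K₁} + t·d`), the tower input `N` (pinned `(1+|x̃|)ʲ`-moments of the four-leg data of `𝒲′[Ψ_{K₁}+t·d]` at the loop strings, loop label ON THE SHELL), the
tree jets `A, A′` and the dressing jets `A_J` at `q`:
`‖Dʲ[evalM (symInterp L (klLocSelfEnergyRe[K₂] − klLocSelfEnergyRe[K₁] − D∘p))](q)‖ ≤ 2·(2|β|L²·12·(2N_ω(N₁+N₂)·βL²(200+200B₁)fd/Λ_n²)·N) + (A+A′)/2 + A_J`.
[cite: BenfattoGiulianiMastropietro2006, §2.3 (2.21)–(2.24)] -/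
theorem norm_iteratedFDeriv_klLocSelfEnergyRe_frame_sub_le
    {B₁ : ℝ} (hB0 : 0 ≤ B₁) (hB : ∀ y, |deriv salmhoferCutoff y| ≤ B₁) (hΛ : 0 < klScale klE0 n)
    {fd : ℝ} (hfd : fd ≤ klScale klE0 n / 4) (hD : ∀ kv : TorusSite 2 L, |(fsub K₂ K₁).eval (latticeMomentum L kv)| ≤ fd)
    {Nω Nk₁ Nk₂ : ℕ} (hNω : (Finset.univ.filter fun i : MatsubaraIdx M => |matsubaraFreq β M i| < klScale klE0 n).card ≤ Nω)
    (hNk₁ : (Finset.univ.filter fun kv : TorusSite 2 L => |nambuXiCT L μ K₁ kv| < klScale klE0 n).card ≤ Nk₁)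
    (hNk₂ : (Finset.univ.filter fun kv : TorusSite 2 L => |nambuXiCT L μ K₂ kv| < klScale klE0 n).card ≤ Nk₂)
    (hZ₂ : IsUnit (effPartitionFn ℂ (normalCovariance L M (uvSymbolCT L M β μ K₂ (klScale klE0 n)))
      (hubbardInteraction L M β U + counterQuadratic L M β K₂)))
    (hZ : ∀ t ∈ Set.Icc (0 : ℝ) 1, effPartitionFn ℂ
      (normalCovariance L M (uvSymbolCT L M β μ K₁ (klScale klE0 n)) + ((t : ℂ)) •
        (normalCovariance L M (fun ks => uvSymbolCT L M β μ K₂ (klScale klE0 n) ks /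
            (1 + uvSymbolCT L M β μ K₂ (klScale klE0 n) ks * (((fsub K₂ K₁).eval (latticeMomentum L ks.1.2) / (β * (L : ℝ) ^ 2) : ℝ) : ℂ))) -
          normalCovariance L M (uvSymbolCT L M β μ K₁ (klScale klE0 n))))
      (hubbardInteraction L M β U + counterQuadratic L M β K₁) ≠ 0)
    (j : ℕ) (q : Momentum) {N A A' AJ : ℝ} (hN0 : 0 ≤ N) (hA0 : 0 ≤ A) (hA0' : 0 ≤ A')
    (hN : ∀ t ∈ Set.Icc (0 : ℝ) 1, ∀ i ∈ ({omega0 M, (omega0 M).rev} : Finset (MatsubaraIdx M)), ∀ σ : Fin 2, ∀ Al : HubbardFieldIdx L M,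
      |matsubaraFreq β M Al.1.1.1| < klScale klE0 n →
      (|nambuXiCT L μ K₁ Al.1.1.2| < klScale klE0 n ∨ |nambuXiCT L μ K₂ Al.1.1.2| < klScale klE0 n) →
      ∑ x : TorusSite 2 L, (1 + ((x 0).valMinAbs.natAbs : ℝ) + ((x 1).valMinAbs.natAbs : ℝ)) ^ j * ‖torusFourierInv (fun kv : TorusSite 2 L =>
        kernel ℂ (effAction ℂ (normalCovariance L M (uvSymbolCT L M β μ K₁ (klScale klE0 n)) + ((t : ℂ)) •
          (normalCovariance L M (fun ks => uvSymbolCT L M β μ K₂ (klScale klE0 n) ks /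
              (1 + uvSymbolCT L M β μ K₂ (klScale klE0 n) ks * (((fsub K₂ K₁).eval (latticeMomentum L ks.1.2) / (β * (L : ℝ) ^ 2) : ℝ) : ℂ))) -
            normalCovariance L M (uvSymbolCT L M β μ K₁ (klScale klE0 n))))
          (hubbardInteraction L M β U + counterQuadratic L M β K₁)) 4
          (Fin.snoc (Fin.snoc ![((((i, kv), σ), 0) : HubbardFieldIdx L M), (((i, kv), σ), 1)] (Al.1, 1 - Al.2) : Fin 3 → HubbardFieldIdx L M) Al)) x‖ ≤ N)
    (hT : ∀ t ∈ Set.Icc (0 : ℝ) 1,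
      ‖iteratedFDeriv ℝ j (evalM (symInterp L (fun kv : TorusSite 2 L => ((∑ σ : Fin 2,
        (selfEnergy L M β (grassmannDerivPairing ℂ
            (normalCovariance L M (fun ks => uvSymbolCT L M β μ K₂ (klScale klE0 n) ks /
                (1 + uvSymbolCT L M β μ K₂ (klScale klE0 n) ks * (((fsub K₂ K₁).eval (latticeMomentum L ks.1.2) / (β * (L : ℝ) ^ 2) : ℝ) : ℂ))) -
              normalCovariance L M (uvSymbolCT L M β μ K₁ (klScale klE0 n)))
            (effAction ℂ (normalCovariance L M (uvSymbolCT L M β μ K₁ (klScale klE0 n)) + ((t : ℂ)) •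
              (normalCovariance L M (fun ks => uvSymbolCT L M β μ K₂ (klScale klE0 n) ks /
                  (1 + uvSymbolCT L M β μ K₂ (klScale klE0 n) ks * (((fsub K₂ K₁).eval (latticeMomentum L ks.1.2) / (β * (L : ℝ) ^ 2) : ℝ) : ℂ))) -
                normalCovariance L M (uvSymbolCT L M β μ K₁ (klScale klE0 n))))
              (hubbardInteraction L M β U + counterQuadratic L M β K₁))
            (effAction ℂ (normalCovariance L M (uvSymbolCT L M β μ K₁ (klScale klE0 n)) + ((t : ℂ)) •
              (normalCovariance L M (fun ks => uvSymbolCT L M β μ K₂ (klScale klE0 n) ks /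
                  (1 + uvSymbolCT L M β μ K₂ (klScale klE0 n) ks * (((fsub K₂ K₁).eval (latticeMomentum L ks.1.2) / (β * (L : ℝ) ^ 2) : ℝ) : ℂ))) -
                normalCovariance L M (uvSymbolCT L M β μ K₁ (klScale klE0 n))))
              (hubbardInteraction L M β U + counterQuadratic L M β K₁))) (omega0 M, kv) σ +
          selfEnergy L M β (grassmannDerivPairing ℂ
            (normalCovariance L M (fun ks => uvSymbolCT L M β μ K₂ (klScale klE0 n) ks /
                (1 + uvSymbolCT L M β μ K₂ (klScale klE0 n) ks * (((fsub K₂ K₁).eval (latticeMomentum L ks.1.2) / (β * (L : ℝ) ^ 2) : ℝ) : ℂ))) -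
              normalCovariance L M (uvSymbolCT L M β μ K₁ (klScale klE0 n)))
            (effAction ℂ (normalCovariance L M (uvSymbolCT L M β μ K₁ (klScale klE0 n)) + ((t : ℂ)) •
              (normalCovariance L M (fun ks => uvSymbolCT L M β μ K₂ (klScale klE0 n) ks /
                  (1 + uvSymbolCT L M β μ K₂ (klScale klE0 n) ks * (((fsub K₂ K₁).eval (latticeMomentum L ks.1.2) / (β * (L : ℝ) ^ 2) : ℝ) : ℂ))) -
                normalCovariance L M (uvSymbolCT L M β μ K₁ (klScale klE0 n))))
              (hubbardInteraction L M β U + counterQuadratic L M β K₁))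
            (effAction ℂ (normalCovariance L M (uvSymbolCT L M β μ K₁ (klScale klE0 n)) + ((t : ℂ)) •
              (normalCovariance L M (fun ks => uvSymbolCT L M β μ K₂ (klScale klE0 n) ks /
                  (1 + uvSymbolCT L M β μ K₂ (klScale klE0 n) ks * (((fsub K₂ K₁).eval (latticeMomentum L ks.1.2) / (β * (L : ℝ) ^ 2) : ℝ) : ℂ))) -
                normalCovariance L M (uvSymbolCT L M β μ K₁ (klScale klE0 n))))
              (hubbardInteraction L M β U + counterQuadratic L M β K₁))) ((omega0 M).rev, kv) σ)) / 4).re))) q‖ ≤ A ∧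
      ‖iteratedFDeriv ℝ j (evalM (symInterp L (fun kv : TorusSite 2 L => ((∑ σ : Fin 2,
        (selfEnergy L M β (grassmannDerivPairing ℂ
            (normalCovariance L M (fun ks => uvSymbolCT L M β μ K₂ (klScale klE0 n) ks /
                (1 + uvSymbolCT L M β μ K₂ (klScale klE0 n) ks * (((fsub K₂ K₁).eval (latticeMomentum L ks.1.2) / (β * (L : ℝ) ^ 2) : ℝ) : ℂ))) -
              normalCovariance L M (uvSymbolCT L M β μ K₁ (klScale klE0 n)))
            (effAction ℂ (normalCovariance L M (uvSymbolCT L M β μ K₁ (klScale klE0 n)) + ((t : ℂ)) •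
              (normalCovariance L M (fun ks => uvSymbolCT L M β μ K₂ (klScale klE0 n) ks /
                  (1 + uvSymbolCT L M β μ K₂ (klScale klE0 n) ks * (((fsub K₂ K₁).eval (latticeMomentum L ks.1.2) / (β * (L : ℝ) ^ 2) : ℝ) : ℂ))) -
                normalCovariance L M (uvSymbolCT L M β μ K₁ (klScale klE0 n))))
              (hubbardInteraction L M β U + counterQuadratic L M β K₁))
            (effAction ℂ (normalCovariance L M (uvSymbolCT L M β μ K₁ (klScale klE0 n)) + ((t : ℂ)) •
              (normalCovariance L M (fun ks => uvSymbolCT L M β μ K₂ (klScale klE0 n) ks /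
                  (1 + uvSymbolCT L M β μ K₂ (klScale klE0 n) ks * (((fsub K₂ K₁).eval (latticeMomentum L ks.1.2) / (β * (L : ℝ) ^ 2) : ℝ) : ℂ))) -
                normalCovariance L M (uvSymbolCT L M β μ K₁ (klScale klE0 n))))
              (hubbardInteraction L M β U + counterQuadratic L M β K₁))) (omega0 M, kv) σ +
          selfEnergy L M β (grassmannDerivPairing ℂ
            (normalCovariance L M (fun ks => uvSymbolCT L M β μ K₂ (klScale klE0 n) ks /
                (1 + uvSymbolCT L M β μ K₂ (klScale klE0 n) ks * (((fsub K₂ K₁).eval (latticeMomentum L ks.1.2) / (β * (L : ℝ) ^ 2) : ℝ) : ℂ))) -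
              normalCovariance L M (uvSymbolCT L M β μ K₁ (klScale klE0 n)))
            (effAction ℂ (normalCovariance L M (uvSymbolCT L M β μ K₁ (klScale klE0 n)) + ((t : ℂ)) •
              (normalCovariance L M (fun ks => uvSymbolCT L M β μ K₂ (klScale klE0 n) ks /
                  (1 + uvSymbolCT L M β μ K₂ (klScale klE0 n) ks * (((fsub K₂ K₁).eval (latticeMomentum L ks.1.2) / (β * (L : ℝ) ^ 2) : ℝ) : ℂ))) -
                normalCovariance L M (uvSymbolCT L M β μ K₁ (klScale klE0 n))))
              (hubbardInteraction L M β U + counterQuadratic L M β K₁))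
            (effAction ℂ (normalCovariance L M (uvSymbolCT L M β μ K₁ (klScale klE0 n)) + ((t : ℂ)) •
              (normalCovariance L M (fun ks => uvSymbolCT L M β μ K₂ (klScale klE0 n) ks /
                  (1 + uvSymbolCT L M β μ K₂ (klScale klE0 n) ks * (((fsub K₂ K₁).eval (latticeMomentum L ks.1.2) / (β * (L : ℝ) ^ 2) : ℝ) : ℂ))) -
                normalCovariance L M (uvSymbolCT L M β μ K₁ (klScale klE0 n))))
              (hubbardInteraction L M β U + counterQuadratic L M β K₁))) ((omega0 M).rev, kv) σ)) / 4).im))) q‖ ≤ A')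
    (hJ : ‖iteratedFDeriv ℝ j (evalM (symInterp L (fun kv : TorusSite 2 L =>
        (∑ σ : Fin 2, ∑ i ∈ ({omega0 M, (omega0 M).rev} : Finset (MatsubaraIdx M)),
          (-(((β * (L : ℝ) ^ 2 : ℝ) : ℂ) * (((fsub K₂ K₁).eval (latticeMomentum L kv) / (β * (L : ℝ) ^ 2) : ℝ) : ℂ) ^ 2 *
              (uvSymbolCT L M β μ K₂ (klScale klE0 n) ((i, kv), σ) /
                (1 + uvSymbolCT L M β μ K₂ (klScale klE0 n) ((i, kv), σ) * (((fsub K₂ K₁).eval (latticeMomentum L kv) / (β * (L : ℝ) ^ 2) : ℝ) : ℂ)))) +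
            ((1 - (((fsub K₂ K₁).eval (latticeMomentum L kv) / (β * (L : ℝ) ^ 2) : ℝ) : ℂ) *
                (uvSymbolCT L M β μ K₂ (klScale klE0 n) ((i, kv), σ) /
                  (1 + uvSymbolCT L M β μ K₂ (klScale klE0 n) ((i, kv), σ) * (((fsub K₂ K₁).eval (latticeMomentum L kv) / (β * (L : ℝ) ^ 2) : ℝ) : ℂ)))) ^ 2 -
                1) *
              selfEnergy L M β (effAction ℂ (normalCovariance L M fun ks =>
                uvSymbolCT L M β μ K₂ (klScale klE0 n) ks /
                  (1 + uvSymbolCT L M β μ K₂ (klScale klE0 n) ks * (((fsub K₂ K₁).eval (latticeMomentum L ks.1.2) / (β * (L : ℝ) ^ 2) : ℝ) : ℂ)))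
              (hubbardInteraction L M β U + counterQuadratic L M β K₁)) (i, kv) σ).re) / 4))) q‖ ≤ AJ) :
    ‖iteratedFDeriv ℝ j (evalM (symInterp L (fun kv : TorusSite 2 L =>
        klLocSelfEnergyRe L M β U μ K₂ n kv - klLocSelfEnergyRe L M β U μ K₁ n kv - (fsub K₂ K₁).eval (latticeMomentum L kv)))) q‖ ≤
      2 * (2 * (|β| * (L : ℝ) ^ 2) * (12 * (2 * (Nω : ℝ) * ((Nk₁ : ℝ) + Nk₂) *
        (β * (L : ℝ) ^ 2 * (200 + 200 * B₁) / klScale klE0 n ^ 2 * fd)) * N)) + (A + A') / 2 + AJ := by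
  have hL : (0 : ℝ) < L := by exact_mod_cast NeZero.pos L
  -- the partition function at frame `K₁` (t = 0 of the line)
  have hZ₁ : IsUnit (effPartitionFn ℂ (normalCovariance L M (uvSymbolCT L M β μ K₁ (klScale klE0 n)))
      (hubbardInteraction L M β U + counterQuadratic L M β K₁)) := by
    have h0 := hZ 0 ⟨le_rfl, zero_le_one⟩
    rw [Complex.ofReal_zero, zero_smul, add_zero] at h0
    exact isUnit_iff_ne_zero.2 h0
  -- the entry sum by the shell count (before abbreviating)
  have hsum := sum_norm_mismatchDefect_le_shell hβ μ K₁ K₂ (klScale klE0 n) hB0 hB hΛ hfd hD hNω hNk₁ hNk₂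
  -- split the data: response + dressing
  rw [klLocSelfEnergyRe_sub_sub_eval_eq hβ U μ K₁ K₂ n hZ₂ hZ₁]
  -- abbreviations (fold everywhere)
  set s₀ : FreqMomentum L M × Fin 2 → ℂ := uvSymbolCT L M β μ K₁ (klScale klE0 n) with hs₀
  set s₁ : FreqMomentum L M × Fin 2 → ℂ := fun ks => uvSymbolCT L M β μ K₂ (klScale klE0 n) ks /
      (1 + uvSymbolCT L M β μ K₂ (klScale klE0 n) ks * (((fsub K₂ K₁).eval (latticeMomentum L ks.1.2) / (β * (L : ℝ) ^ 2) : ℝ) : ℂ)) with hs₁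
  rw [evalM_symInterp_add]
  have hc : ∀ f : TorusSite 2 L → ℝ, ContDiff ℝ j (evalM (symInterp L f)) := fun f => (contDiff_evalM _).of_le le_top
  rw [fun_iteratedFDeriv_add_apply (hc _).contDiffAt (hc _).contDiffAt]
  refine (norm_add_le _ _).trans (add_le_add ?_ hJ)
  -- the response part: the per-functional door with the support-restricted tower input
  have hsupp : ∀ t ∈ Set.Icc (0 : ℝ) 1, ∀ i ∈ ({omega0 M, (omega0 M).rev} : Finset (MatsubaraIdx M)), ∀ σ : Fin 2, ∀ Al : HubbardFieldIdx L M,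
      s₁ Al.1 - s₀ Al.1 ≠ 0 →
      ∑ x : TorusSite 2 L, (1 + ((x 0).valMinAbs.natAbs : ℝ) + ((x 1).valMinAbs.natAbs : ℝ)) ^ j * ‖torusFourierInv (fun kv : TorusSite 2 L =>
        kernel ℂ (effAction ℂ (normalCovariance L M s₀ + ((t : ℂ)) • (normalCovariance L M s₁ - normalCovariance L M s₀))
          (hubbardInteraction L M β U + counterQuadratic L M β K₁)) 4
          (Fin.snoc (Fin.snoc ![((((i, kv), σ), 0) : HubbardFieldIdx L M), (((i, kv), σ), 1)] (Al.1, 1 - Al.2) : Fin 3 → HubbardFieldIdx L M) Al)) x‖ ≤ N := by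
    intro t ht i hi σ Al hAl
    obtain ⟨⟨⟨ia, ka⟩, τ⟩, c⟩ := Al
    have hsq : ∀ {x : ℝ}, klScale klE0 n ≤ |x| → klScale klE0 n ^ 2 ≤ x ^ 2 := fun {x} h1 => by
      calc klScale klE0 n ^ 2 ≤ |x| ^ 2 := by gcongr
        _ = x ^ 2 := sq_abs _
    by_cases hω : |matsubaraFreq β M ia| < klScale klE0 n
    · by_cases he : |nambuXiCT L μ K₁ ka| < klScale klE0 n ∨ |nambuXiCT L μ K₂ ka| < klScale klE0 n
      · exact hN t ht i hi σ _ hω he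
      · exfalso
        push Not at he
        refine hAl ?_
        show s₁ ((ia, ka), τ) - s₀ ((ia, ka), τ) = 0
        exact mismatchDefect_eq_zero_of_ge hβ μ K₁ K₂ (klScale klE0 n) hΛ ia ka τ
          ((hsq he.2).trans (le_add_of_nonneg_left (sq_nonneg _))) ((hsq he.1).trans (le_add_of_nonneg_left (sq_nonneg _)))
    · exfalso
      refine hAl ?_
      show s₁ ((ia, ka), τ) - s₀ ((ia, ka), τ) = 0
      exact mismatchDefect_eq_zero_of_freq_ge hβ μ K₁ K₂ (klScale klE0 n) hΛ ia ka τ (not_lt.1 hω)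
  have hdoor := covRespCT_readingJet_sub_le s₀ s₁ β U K₁ (omega0 M) (omega0 M).rev j q hZ hN0 hA0 hA0' hsupp hT
  refine hdoor.trans ?_
  have hfd0 : 0 ≤ fd := (abs_nonneg _).trans (hD 0)
  gcongr

end Door

end Summit.HubbardSuperconductivity.HubbardSuperconductivity.Theorems.EngineV8

end
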